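import Mathlib
import Literature.MathematicalPhysics.QuantumLattice.GrassmannKernels

/-!
# Crux `SeededBrokenRegimeBoseFermiPinned` (stmt-HubbardSuperconductivity-14047), line `seed-strength-flow`:
# the coefficientwise Gaussian-parameter flow equation (stub `stub_gaussConvFlow`, S11)

Support file (`--supports stmt-HubbardSuperconductivity-14047`).  Along a covariance path
`t ↦ C_t` on a finite label set `Γ` which is differentiable entrywise at `t`, every kernel
(coefficient function) of the Grassmann Gaussian convolution `μ_{C_s} ⋆ F = e^{Δ_{C_s}} F` is
differentiable in `s` at `t`, with derivative the corresponding kernel of `Δ_{Ċ_t} (μ_{C_t} ⋆ F)`: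
Salmhofer's renormalization group differential equation `∂_t e^{Δ_{C_t}} F = Δ_{Ċ_t} e^{Δ_{C_t}} F`
(Salmhofer 1999, Prop. 4.3, (4.89)) for an arbitrary differentiable covariance path, stated
coefficientwise because the Grassmann algebra `GrassmannAlgebra ℂ Γ` carries no norm.

## Proof

* By the semigroup property (`gaussConv_add_apply`), `μ_{C_s} ⋆ F = μ_{D_s} ⋆ G` with
  `G := μ_{C_t} ⋆ F`, `D_s := C_s - C_t`, so `D_t = 0` and `Ḋ_t = Ċ_t`.
* **Uniform nilpotency** (`grassmannLaplacian_pow_finrank`): `Δ_D ^ N = 0` for the single exponent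
  `N := dim_ℂ GrassmannAlgebra ℂ Γ`, for every `D` (Cayley–Hamilton for the nilpotent endomorphism
  `Δ_D`, `isNilpotent_grassmannLaplacian`), so `μ_{D_s} ⋆ G = Σ_{k < N+2} (k!)⁻¹ Δ_{D_s}^k G` with an
  `s`-independent range (`IsNilpotent.exp_eq_sum`).
* For a linear functional `φ` (the kernel `F ↦ kernel F m X` is one), one Laplacian step
  `φ (Δ_{D_s} g_s) = ½ Σ_{X,Y} D_s(X,Y) · φ (∂_X ∂_Y g_s)` is a finite sum of products of scalar
  functions (`hasDerivAt_apply_grassmannLaplacian`, product rule); by induction every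
  `s ↦ φ (Δ_{D_s}^k G)` is differentiable at `t`; the `k = 0` term is constant, the `k = 1` term has
  derivative `φ (Δ_{Ċ_t} G)`, and every `k ≥ 2` term has derivative `0` because both factors of each
  product vanish at `s = t` (`D_t = 0`).
-/

set_option linter.dupNamespace false -- Summit.<S>.<S> doubles the summit name (tree convention)

namespace Summit.HubbardSuperconductivity.HubbardSuperconductivity.Theorems.AposterioriCapRgSeededBrokenRegimeBoseFermiPinned

open Literature.MathematicalPhysics.QuantumLattice GrassmannAlgebra

section FlowLemmas

variable {Γ : Type} [Fintype Γ]

/-- **Uniform nilpotency of the fermionic Laplacian**: `Δ_D ^ N = 0` with the `D`-independent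
exponent `N = dim_ℂ` of the Grassmann algebra (Cayley–Hamilton for the nilpotent endomorphism
`Δ_D`). -/
theorem grassmannLaplacian_pow_finrank (D : Matrix Γ Γ ℂ) :
    grassmannLaplacian ℂ D ^ Module.finrank ℂ (GrassmannAlgebra ℂ Γ) = 0 := by
  classical
  letI : LinearOrder Γ := LinearOrder.lift' (Fintype.equivFin Γ) (Fintype.equivFin Γ).injective
  haveI : Module.Finite ℂ (GrassmannAlgebra ℂ Γ) := Module.Finite.of_basis (grassmannBasis ℂ Γ)
  have h := (isNilpotent_grassmannLaplacian ℂ D).charpoly_eq_X_pow_finrank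
  have h2 := (grassmannLaplacian ℂ D).aeval_self_charpoly
  rwa [h, map_pow, Polynomial.aeval_X] at h2

variable (D : ℝ → Matrix Γ Γ ℂ) (D' : Matrix Γ Γ ℂ) (t : ℝ)
  (hD : ∀ X Y, HasDerivAt (fun s => D s X Y) (D' X Y) t)
include hD

/-- **One Laplacian step of the flow** (product rule): if every `s ↦ φ (∂_X ∂_Y g_s)` is
differentiable at `t`, so is `s ↦ φ (Δ_{D_s} g_s) = ½ Σ_{X,Y} D_s(X,Y) φ (∂_X ∂_Y g_s)`. -/
theorem hasDerivAt_apply_grassmannLaplacian (φ : GrassmannAlgebra ℂ Γ →ₗ[ℂ] ℂ)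
    (g : ℝ → GrassmannAlgebra ℂ Γ) (g' : Γ → Γ → ℂ)
    (hg : ∀ X Y, HasDerivAt (fun s => φ (grassmannDeriv ℂ X (grassmannDeriv ℂ Y (g s)))) (g' X Y) t) :
    HasDerivAt (fun s => φ (grassmannLaplacian ℂ (D s) (g s)))
      (((1 / 2 : ℚ) • (1 : ℂ)) * ∑ X, ∑ Y,
        (D' X Y * φ (grassmannDeriv ℂ X (grassmannDeriv ℂ Y (g t))) + D t X Y * g' X Y)) t := by
  have hfun : (fun s => φ (grassmannLaplacian ℂ (D s) (g s))) = fun s =>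
      ((1 / 2 : ℚ) • (1 : ℂ)) * ∑ X, ∑ Y, D s X Y * φ (grassmannDeriv ℂ X (grassmannDeriv ℂ Y (g s))) := by
    funext s
    rw [grassmannLaplacian_apply, map_smul, map_sum, smul_eq_mul]
    refine congrArg _ (Finset.sum_congr rfl fun X _ => ?_)
    rw [map_sum]
    refine Finset.sum_congr rfl fun Y _ => ?_
    rw [map_smul, smul_eq_mul]
  rw [hfun]
  refine HasDerivAt.const_mul _ (HasDerivAt.fun_sum fun X _ => HasDerivAt.fun_sum fun Y _ => ?_)
  exact (hD X Y).fun_mul (hg X Y)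

/-- Every `s ↦ φ (Δ_{D_s}^k G)` is differentiable at `t` (induction on `k` over all linear
functionals `φ`). -/
theorem exists_hasDerivAt_apply_grassmannLaplacian_pow (G : GrassmannAlgebra ℂ Γ) (k : ℕ)
    (φ : GrassmannAlgebra ℂ Γ →ₗ[ℂ] ℂ) :
    ∃ f' : ℂ, HasDerivAt (fun s => φ ((grassmannLaplacian ℂ (D s) ^ k) G)) f' t := by
  induction k generalizing φ with
  | zero =>
    refine ⟨0, ?_⟩
    simp only [pow_zero, Module.End.one_apply]
    exact hasDerivAt_const t _
  | succ k ih =>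
    have hg : ∀ X Y, ∃ f' : ℂ, HasDerivAt (fun s => (φ ∘ₗ (grassmannDeriv ℂ X * grassmannDeriv ℂ Y))
        ((grassmannLaplacian ℂ (D s) ^ k) G)) f' t := fun X Y => ih _
    choose g' hg' using hg
    have hfun : (fun s => φ ((grassmannLaplacian ℂ (D s) ^ (k + 1)) G)) = fun s =>
        φ (grassmannLaplacian ℂ (D s) ((grassmannLaplacian ℂ (D s) ^ k) G)) := by
      funext s
      rw [pow_succ', Module.End.mul_apply]
    rw [hfun]
    exact ⟨_, hasDerivAt_apply_grassmannLaplacian D D' t hD φ _ g' hg'⟩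

/-- The linear term of the flow: `s ↦ φ (Δ_{D_s} G)` has derivative `φ (Δ_{Ḋ_t} G)`. -/
theorem hasDerivAt_apply_grassmannLaplacian_const (G : GrassmannAlgebra ℂ Γ)
    (φ : GrassmannAlgebra ℂ Γ →ₗ[ℂ] ℂ) :
    HasDerivAt (fun s => φ (grassmannLaplacian ℂ (D s) G)) (φ (grassmannLaplacian ℂ D' G)) t := by
  refine (hasDerivAt_apply_grassmannLaplacian D D' t hD φ (fun _ => G) (fun _ _ => 0)
    fun X Y => hasDerivAt_const t _).congr_deriv ?_
  rw [grassmannLaplacian_apply, map_smul, map_sum, smul_eq_mul]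
  refine congrArg _ (Finset.sum_congr rfl fun X _ => ?_)
  rw [map_sum]
  refine Finset.sum_congr rfl fun Y _ => ?_
  rw [map_smul, smul_eq_mul, mul_zero, add_zero]

/-- The higher terms of the flow: if `D_t = 0`, every `s ↦ φ (Δ_{D_s}^{k+2} G)` has derivative `0`
at `t` (both factors of each product vanish at `s = t`). -/
theorem hasDerivAt_apply_grassmannLaplacian_pow_add_two (hDt : D t = 0) (G : GrassmannAlgebra ℂ Γ)
    (k : ℕ) (φ : GrassmannAlgebra ℂ Γ →ₗ[ℂ] ℂ) :
    HasDerivAt (fun s => φ ((grassmannLaplacian ℂ (D s) ^ (k + 2)) G)) 0 t := by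
  have hg : ∀ X Y, ∃ f' : ℂ, HasDerivAt (fun s => (φ ∘ₗ (grassmannDeriv ℂ X * grassmannDeriv ℂ Y))
      ((grassmannLaplacian ℂ (D s) ^ (k + 1)) G)) f' t := fun X Y =>
    exists_hasDerivAt_apply_grassmannLaplacian_pow D D' t hD G (k + 1) _
  choose g' hg' using hg
  have hfun : (fun s => φ ((grassmannLaplacian ℂ (D s) ^ (k + 2)) G)) = fun s =>
      φ (grassmannLaplacian ℂ (D s) ((grassmannLaplacian ℂ (D s) ^ (k + 1)) G)) := by
    funext s
    rw [pow_succ', Module.End.mul_apply]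
  rw [hfun]
  refine (hasDerivAt_apply_grassmannLaplacian D D' t hD φ _ g' hg').congr_deriv ?_
  simp [hDt, zero_pow (Nat.succ_ne_zero k)]

/-- **The flow equation for a linear functional**: if `D_t = 0` and `Ḋ_t = D'` entrywise, then
`s ↦ φ (μ_{D_s} ⋆ G)` has derivative `φ (Δ_{D'} G)` at `t`. -/
theorem hasDerivAt_apply_gaussConv (hDt : D t = 0) (G : GrassmannAlgebra ℂ Γ)
    (φ : GrassmannAlgebra ℂ Γ →ₗ[ℂ] ℂ) :
    HasDerivAt (fun s => φ (gaussConv ℂ (D s) G)) (φ (grassmannLaplacian ℂ D' G)) t := by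
  set N := Module.finrank ℂ (GrassmannAlgebra ℂ Γ) with hN
  -- uniform truncation of the exponential series
  have hexp : ∀ s, φ (gaussConv ℂ (D s) G) =
      ∑ k ∈ Finset.range (N + 2), ((k.factorial : ℚ)⁻¹ : ℂ) * φ ((grassmannLaplacian ℂ (D s) ^ k) G) := by
    intro s
    have hnil : grassmannLaplacian ℂ (D s) ^ (N + 2) = 0 :=
      pow_eq_zero_of_le (by omega) (grassmannLaplacian_pow_finrank (D s))
    rw [gaussConv_def, IsNilpotent.exp_eq_sum hnil, LinearMap.sum_apply, map_sum]
    refine Finset.sum_congr rfl fun k _ => ?_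
    rw [LinearMap.smul_apply, ← Rat.cast_smul_eq_qsmul ℂ, map_smul, smul_eq_mul, Rat.cast_inv]
  have hk : ∀ k, HasDerivAt (fun s => φ ((grassmannLaplacian ℂ (D s) ^ k) G))
      (if k = 1 then φ (grassmannLaplacian ℂ D' G) else 0) t := by
    intro k
    match k with
    | 0 =>
      rw [if_neg Nat.zero_ne_one]
      simp only [pow_zero, Module.End.one_apply]
      exact hasDerivAt_const t _
    | 1 =>
      rw [if_pos rfl]
      simp only [pow_one]
      exact hasDerivAt_apply_grassmannLaplacian_const D D' t hD G φ
    | k + 2 =>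
      rw [if_neg (by omega)]
      exact hasDerivAt_apply_grassmannLaplacian_pow_add_two D D' t hD hDt G k φ
  rw [show (fun s => φ (gaussConv ℂ (D s) G)) = fun s => ∑ k ∈ Finset.range (N + 2),
      ((k.factorial : ℚ)⁻¹ : ℂ) * φ ((grassmannLaplacian ℂ (D s) ^ k) G) from funext hexp]
  refine (HasDerivAt.fun_sum fun k _ => (hk k).const_mul _).congr_deriv ?_
  rw [Finset.sum_eq_single 1]
  · simp
  · intro k _ hk1
    rw [if_neg hk1, mul_zero]
  · intro h
    exact absurd (Finset.mem_range.2 (by omega)) h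

end FlowLemmas

/-- **S11 (`GaussConvFlow`), the coefficientwise Gaussian-parameter flow equation**: along a
covariance path `t ↦ C_t` on a finite label set `Γ`, differentiable entrywise at `t` with
derivative `C'`, every kernel of the Gaussian convolution `μ_{C_s} ⋆ F = e^{Δ_{C_s}} F` is
differentiable in `s` at `t`, with derivative the corresponding kernel of `Δ_{C'} (μ_{C_t} ⋆ F)`:
Salmhofer's RG differential equation `∂_t (e^{Δ_{C_t}} F) = Δ_{Ċ_t} e^{Δ_{C_t}} F` (the Laplacians
commute) for an arbitrary differentiable covariance path, read coefficient by coefficient.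
[cite: Salmhofer1999, Prop. 4.3 (4.89)] -/
theorem stub_gaussConvFlow :
    ∀ {Γ : Type} [Fintype Γ] [DecidableEq Γ] (C : ℝ → Matrix Γ Γ ℂ) (C' : Matrix Γ Γ ℂ) (t : ℝ),
      (∀ X Y, HasDerivAt (fun s => C s X Y) (C' X Y) t) →
      ∀ (F : GrassmannAlgebra ℂ Γ) (m : ℕ) (X : Fin m → Γ),
        HasDerivAt (fun s => kernel ℂ (gaussConv ℂ (C s) F) m X)
          (kernel ℂ (grassmannLaplacian ℂ C' (gaussConv ℂ (C t) F)) m X) t := by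
  intro Γ _ _ C C' t hC F m X
  -- the kernel `a ↦ kernel a m X` as a linear functional
  set φ : GrassmannAlgebra ℂ Γ →ₗ[ℂ] ℂ :=
    ((m.factorial : ℚ)⁻¹ • (1 : ℂ)) • ((constPart ℂ (Γ := Γ)).toLinearMap ∘ₗ iterDeriv ℂ X) with hφ
  have hker : ∀ a, kernel ℂ a m X = φ a := fun a => rfl
  -- the seed-slice path `D_s = C_s - C_t`, `D_t = 0`, `Ḋ_t = C'`
  have hD : ∀ X Y, HasDerivAt (fun s => (C s - C t) X Y) (C' X Y) t := fun X Y =>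
    (hC X Y).sub_const (C t X Y)
  have key := hasDerivAt_apply_gaussConv (fun s => C s - C t) C' t hD (sub_self _)
    (gaussConv ℂ (C t) F) φ
  have hfun : (fun s => kernel ℂ (gaussConv ℂ (C s) F) m X) =
      fun s => φ (gaussConv ℂ (C s - C t) (gaussConv ℂ (C t) F)) := by
    funext s
    rw [hker, ← gaussConv_add_apply, sub_add_cancel]
  rw [hfun, hker]
  exact key

end Summit.HubbardSuperconductivity.HubbardSuperconductivity.Theorems.AposterioriCapRgSeededBrokenRegimeBoseFermiPinned
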